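import Literature.NumberTheory.GaloisRepresentations.ArchimedeanLocalDuality
import Literature.NumberTheory.GaloisRepresentations.LocalDualityDescent
import HarnessLib

/-!
# Biduality `M ⥲ M^{DD} = Hom(Hom(M, μₙ), μₙ)` of a finite `n`-torsion discrete Galois module,
# as CANONICAL intertwining maps, and the double transpose of an adjoint pair

Topic `NumberTheory/GaloisRepresentations`; namespace
`Literature.NumberTheory.GaloisRepresentations.DiscreteGaloisModule`.  Definitions WITH BODIES
(`bidual`, `bidualEquiv`, `bidualInv`, `doubleTranspose`; and the theorem `tateDualEval_bijective`) and theorems; no named fact, no `sorry`, no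
instance, no notation.

Milne, *ADT* I §0 Prop. 0.19 / §2 ("`M^{DD} = M` canonically"): the evaluation map `m ↦ (f ↦ f m)` is a
`Γ_K`-equivariant bijection `M ≅ M^{DD}` for a finite `M` killed by `n ≥ 1` (characters into
`μₙ ≅ ℤ/n` separate points; `#M^D = #M`).  The tree had the additive evaluation `tateDualEval` and its
injectivity (`tateDualEval_injective`), and the pair of inverse intertwining maps only EXISTENTIALLY
(Summits-side `…PoitouTateBidualTransport.exists_bidual_intertwining`).  For NATURALITY statements
(lane «PT-Ш-S-TC» of cell `bsd-eis`, brick D5c: the transport `H²(G_S, M^{DD}) ≅ H²(G_S, M)` in the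
`Ext` road must commute with module maps) the maps have to be DEFINITIONS:

* §1 `bidual ρ n : M →ⁱL M^{DD}` (`m ↦ (f ↦ f m)`), `bidual_apply`, `bidual_bijective` (`CharZero K`,
  `n ≥ 1`, `n • M = 0`), the additive equivalence `bidualEquiv` and the inverse intertwining map
  `bidualInv` with `bidualInv_bidual`, `bidual_bidualInv`;
* §2 the DOUBLE TRANSPOSE of a pair `(F : M → M', G : M'^D(n') → M^D(n))` ADJOINT for the Cartier
  pairings (`(G φ')(m) = φ'(F m)` in `K̄ˣ`): `doubleTranspose := bidual' ∘ F ∘ bidualInv :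
  M^{DD}(n) →ⁱL M'^{DD}(n')` (no inclusion `μₙ ⊆ μ_{n'}` is needed), with
  `doubleTranspose_bidual : F^{DD}(ι m) = ι'(F m)`, `bidualInv_doubleTranspose : κ'(F^{DD} ψ) = F(κ ψ)`
  and the adjointness of `(G, F^{DD})`: `(F^{DD} ψ)(φ') = ψ(G φ')` in `K̄ˣ`
  (`toUnits_doubleTranspose_apply`).

No arithmetic beyond Prop. 0.19; nothing about Poitou–Tate or BSD is proved here.
AI formalisation, weaker than expert review; established only by the kernel check.

## References
* J. S. Milne, *Arithmetic Duality Theorems*, 2nd ed. (2006), Ch. I §0 Prop. 0.19, §2 (`M^{DD} = M`),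
  §4 p. 56. [MilneADT2006]
-/

noncomputable section

open Function Field
open scoped ContRepresentation

universe u

namespace Literature.NumberTheory.GaloisRepresentations

namespace DiscreteGaloisModule

variable {K : Type u} [Field K] {M : Type u} [AddCommGroup M] [TopologicalSpace M]
  [DiscreteTopology M] [Finite M] (ρ : DiscreteGaloisModule K M) (n : ℕ)

/-! ## §1 The biduality map and its inverse -/

omit [TopologicalSpace M] [DiscreteTopology M] in
variable (K M) in
/-- **`M → M^{DD}` (the evaluation `tateDualEval`) is bijective** for `M` finite killed by `n ≥ 1` over a
field of characteristic `0` (injective: `tateDualEval_injective`; then `#M^{DD} = #M^D = #M`).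
[cite: MilneADT2006, Ch. I §0, Prop. 0.19] -/
theorem tateDualEval_bijective [CharZero K] [NeZero n] [Finite (TateDual K M n)]
    (hM : ∀ m : M, n • m = 0) :
    Bijective (tateDualEval K M n : M →+ TateDual K (TateDual K M n) n) := by
  have hinj : Injective (tateDualEval K M n : M →+ TateDual K (TateDual K M n) n) :=
    tateDualEval_injective (K := K) (M := M) n hM
  have hD : ∀ f : TateDual K M n, n • f = 0 := fun f => TateDual.nsmul_eq_zero f
  have hc1 : Nat.card (TateDual K M n) = Nat.card M := HomCarrier.natCard_eq (muEquivZMod K n) hM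
  have hc2 : Nat.card (TateDual K (TateDual K M n) n) = Nat.card (TateDual K M n) :=
    HomCarrier.natCard_eq (muEquivZMod K n) hD
  haveI hfin : Finite (TateDual K (TateDual K M n) n) := TateDual.finite K (TateDual K M n) n
  haveI : Finite (TateDual K M n →+ MuCarrier K n) := hfin
  refine hinj.bijective_of_nat_card_le ?_
  change Nat.card (TateDual K (TateDual K M n) n) ≤ Nat.card M
  rw [hc2, hc1]

omit [TopologicalSpace M] [DiscreteTopology M] in
variable (K M) in
/-- The biduality as an additive equivalence `M ≃+ M^{DD}`. [cite: MilneADT2006, Ch. I §0, Prop. 0.19] -/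
def bidualEquiv [CharZero K] [NeZero n] [Finite (TateDual K M n)] (hM : ∀ m : M, n • m = 0) :
    M ≃+ TateDual K (TateDual K M n) n :=
  AddEquiv.ofBijective (tateDualEval K M n : M →+ TateDual K (TateDual K M n) n)
    (tateDualEval_bijective K M n hM)

omit [TopologicalSpace M] [DiscreteTopology M] in
/-- `bidualEquiv` is evaluation on elements. [cite: MilneADT2006, Ch. I §0, Prop. 0.19] -/
@[simp] theorem bidualEquiv_apply_apply [CharZero K] [NeZero n] [Finite (TateDual K M n)]
    (hM : ∀ m : M, n • m = 0) (m : M) (f : TateDual K M n) : bidualEquiv K M n hM m f = f m := rfl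

variable [Finite (TateDual K M n)]

/-- **Biduality `M → M^{DD} = Hom(Hom(M, μₙ), μₙ)`, `m ↦ (f ↦ f m)`, as a continuous `Γ_K`-intertwining
map** (the tree's `tateDualEval`; equivariance from `(σ φ)(f) = σ(φ(σ⁻¹ f))` twice).
[cite: MilneADT2006, Ch. I §0, Prop. 0.19] -/
def bidual : ρ.toContRepresentation →ⁱL ((ρ.tateDual n).tateDual n).toContRepresentation where
  toContinuousLinearMap :=
    ⟨(tateDualEval K M n : M →+ TateDual K (TateDual K M n) n).toIntLinearMap, continuous_of_discreteTopology⟩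
  isIntertwining' σ := by
    refine ContinuousLinearMap.ext fun m => ?_
    change (tateDualEval K M n (ρ σ m) : TateDual K (TateDual K M n) n) =
      (ρ.tateDual n).tateDual n σ (tateDualEval K M n m : TateDual K (TateDual K M n) n)
    refine TateDual.ext fun f => ?_
    change f (ρ σ m) =
      (((ρ.tateDual n).tateDual n) σ (tateDualEval K M n m : TateDual K (TateDual K M n) n)) f
    rw [tateDual_apply_apply_apply]
    change f (ρ σ m) = mu K n σ (((ρ.tateDual n) σ⁻¹ f) m)
    rw [tateDual_apply_apply_apply, inv_inv, ← Module.End.mul_apply, ← map_mul, mul_inv_cancel, map_one,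
      Module.End.one_apply]

/-- `bidual ρ n m f = f m`. [cite: MilneADT2006, Ch. I §0, Prop. 0.19] -/
@[simp] theorem bidual_apply (m : M) (f : TateDual K M n) : bidual ρ n m f = f m := rfl

/-- **`M → M^{DD}` is bijective** (as an intertwining map). [cite: MilneADT2006, Ch. I §0, Prop. 0.19] -/
theorem bidual_bijective [CharZero K] [NeZero n] (hM : ∀ m : M, n • m = 0) : Bijective (bidual ρ n) :=
  tateDualEval_bijective K M n hM

/-- **The inverse biduality `κ : M^{DD} → M` as a continuous `Γ_K`-intertwining map.**
[cite: MilneADT2006, Ch. I §0, Prop. 0.19] -/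
def bidualInv [CharZero K] [NeZero n] (hM : ∀ m : M, n • m = 0) :
    ((ρ.tateDual n).tateDual n).toContRepresentation →ⁱL ρ.toContRepresentation where
  toContinuousLinearMap := ⟨(bidualEquiv K M n hM).symm.toAddMonoidHom.toIntLinearMap,
    continuous_of_discreteTopology⟩
  isIntertwining' σ := by
    refine ContinuousLinearMap.ext fun ψ => ?_
    change (bidualEquiv K M n hM).symm (((ρ.tateDual n).tateDual n) σ ψ) = ρ σ ((bidualEquiv K M n hM).symm ψ)
    apply (bidualEquiv K M n hM).injective
    rw [AddEquiv.apply_symm_apply]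
    have h := DFunLike.congr_fun ((bidual ρ n).isIntertwining' σ) ((bidualEquiv K M n hM).symm ψ)
    change bidual ρ n (ρ σ ((bidualEquiv K M n hM).symm ψ)) =
      (ρ.tateDual n).tateDual n σ (bidual ρ n ((bidualEquiv K M n hM).symm ψ)) at h
    change _ = bidual ρ n (ρ σ ((bidualEquiv K M n hM).symm ψ))
    rw [h]
    change ((ρ.tateDual n).tateDual n) σ ψ =
      ((ρ.tateDual n).tateDual n) σ (bidualEquiv K M n hM ((bidualEquiv K M n hM).symm ψ))
    rw [AddEquiv.apply_symm_apply]

/-- `κ (ι m) = m`. [cite: MilneADT2006, Ch. I §0, Prop. 0.19] -/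
@[simp] theorem bidualInv_bidual [CharZero K] [NeZero n] (hM : ∀ m : M, n • m = 0) (m : M) :
    bidualInv ρ n hM (bidual ρ n m) = m :=
  (bidualEquiv K M n hM).symm_apply_apply m

/-- `ι (κ ψ) = ψ`. [cite: MilneADT2006, Ch. I §0, Prop. 0.19] -/
@[simp] theorem bidual_bidualInv [CharZero K] [NeZero n] (hM : ∀ m : M, n • m = 0)
    (ψ : TateDual K (TateDual K M n) n) : bidual ρ n (bidualInv ρ n hM ψ) = ψ :=
  (bidualEquiv K M n hM).apply_symm_apply ψ

/-! ## §2 The double transpose of an adjoint pair -/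

variable {M' : Type u} [AddCommGroup M'] [TopologicalSpace M'] [DiscreteTopology M'] [Finite M']
  (ρ' : DiscreteGaloisModule K M') (n' : ℕ) [Finite (TateDual K M' n')]

/-- **The double transpose `F^{DD} := ι' ∘ F ∘ κ : M^{DD}(n) → M'^{DD}(n')`** of a continuous
`Γ_K`-map `F : M → M'` (levels `n`, `n'` arbitrary: no inclusion `μₙ ⊆ μ_{n'}` enters).
[cite: MilneADT2006, Ch. I §0, Prop. 0.19] -/
def doubleTranspose [CharZero K] [NeZero n] (hM : ∀ m : M, n • m = 0)
    (F : ρ.toContRepresentation →ⁱL ρ'.toContRepresentation) :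
    ((ρ.tateDual n).tateDual n).toContRepresentation →ⁱL ((ρ'.tateDual n').tateDual n').toContRepresentation :=
  ((bidual ρ' n').comp F).comp (bidualInv ρ n hM)

/-- Unfolding `doubleTranspose`. [cite: MilneADT2006, Ch. I §0, Prop. 0.19] -/
theorem doubleTranspose_apply [CharZero K] [NeZero n] (hM : ∀ m : M, n • m = 0)
    (F : ρ.toContRepresentation →ⁱL ρ'.toContRepresentation) (ψ : TateDual K (TateDual K M n) n) :
    doubleTranspose ρ n ρ' n' hM F ψ = bidual ρ' n' (F (bidualInv ρ n hM ψ)) := rfl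

/-- **`F^{DD} ∘ ι = ι' ∘ F`**: biduality is natural. [cite: MilneADT2006, Ch. I §0, Prop. 0.19] -/
theorem doubleTranspose_bidual [CharZero K] [NeZero n] (hM : ∀ m : M, n • m = 0)
    (F : ρ.toContRepresentation →ⁱL ρ'.toContRepresentation) (m : M) :
    doubleTranspose ρ n ρ' n' hM F (bidual ρ n m) = bidual ρ' n' (F m) := by
  rw [doubleTranspose_apply, bidualInv_bidual]

/-- **`κ' ∘ F^{DD} = F ∘ κ`**: the inverse biduality is natural.
[cite: MilneADT2006, Ch. I §0, Prop. 0.19] -/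
theorem bidualInv_doubleTranspose [CharZero K] [NeZero n] [NeZero n'] (hM : ∀ m : M, n • m = 0)
    (hM' : ∀ m' : M', n' • m' = 0) (F : ρ.toContRepresentation →ⁱL ρ'.toContRepresentation)
    (ψ : TateDual K (TateDual K M n) n) :
    bidualInv ρ' n' hM' (doubleTranspose ρ n ρ' n' hM F ψ) = F (bidualInv ρ n hM ψ) := by
  rw [doubleTranspose_apply, bidualInv_bidual]

/-- **The double transpose is adjoint to `G`**: if `(G φ')(m) = φ'(F m)` in `K̄ˣ` for all `φ'`, `m`
(an adjoint pair for the Cartier pairings), then `(F^{DD} ψ)(φ') = ψ (G φ')` in `K̄ˣ` for all `ψ`, `φ'`.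
[cite: MilneADT2006, Ch. I §0, Prop. 0.19] -/
theorem toUnits_doubleTranspose_apply [CharZero K] [NeZero n] (hM : ∀ m : M, n • m = 0)
    (F : ρ.toContRepresentation →ⁱL ρ'.toContRepresentation)
    (G : TateDual K M' n' → TateDual K M n)
    (hFG : ∀ (φ' : TateDual K M' n') (m : M),
      ((Additive.toMul (G φ' m) : rootsOfUnity n (AlgebraicClosure K)) : (AlgebraicClosure K)ˣ) =
        ((Additive.toMul (φ' (F m)) : rootsOfUnity n' (AlgebraicClosure K)) : (AlgebraicClosure K)ˣ))
    (ψ : TateDual K (TateDual K M n) n) (φ' : TateDual K M' n') :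
    ((Additive.toMul (doubleTranspose ρ n ρ' n' hM F ψ φ') : rootsOfUnity n' (AlgebraicClosure K)) :
        (AlgebraicClosure K)ˣ) =
      ((Additive.toMul (ψ (G φ')) : rootsOfUnity n (AlgebraicClosure K)) : (AlgebraicClosure K)ˣ) := by
  -- write `ψ = ι m` with `m = κ ψ`
  have hψ : ψ = bidual ρ n (bidualInv ρ n hM ψ) := (bidual_bidualInv ρ n hM ψ).symm
  conv_rhs => rw [hψ]
  rw [doubleTranspose_apply, bidual_apply, bidual_apply, hFG]

end DiscreteGaloisModule

end Literature.NumberTheory.GaloisRepresentations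

end
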